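import Summits.ValiantsHypothesis.ValiantsHypothesis.Theorems.DefinabilityGapGhostThree
import Summits.ValiantsHypothesis.ValiantsHypothesis.Theorems.DefinabilityGapPivotLive
import HarnessLib

/-!
# DefinabilityGap — a GENERIC kernel checker for one-column pivot certificates (all `m`)

Route `route-ValiantsHypothesis-DefinabilityGap`, residual crux `KIPlantedHitting` (item 23547),
rung `R_K1.1`, ROAD P.  `DefinabilityGapGhostFour` certified one `m = 4` family by an ad-hoc
transport; this file makes the pipeline GENERIC: a pivot certificate for the planted design with
parameter `m` (prime `q = qOf m` supplied as a hypothesis `qOf m = q`) is DATA — a list `L` of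
curves `(c₀,c₁,c₂) ∈ ℕ³`, a pivot column `s₀`, a pivot row `row t` and a transversal `sig t` per
curve — and ONE BOOLEAN `pivotCheckB m q L s₀ row sig` (bounds; pairwise distinct pivot cells;
each `sig t` a permutation through the pivot; off column `s₀` no transversal cell of `t` is the
gadget cell of another listed curve with that pivot row), evaluated by `decide` in the kernel on
the explicit `ℕ`-model `mcell`.  SOUNDNESS (`kiPivotCertificate_of_checkB`,
`algebraicIndependent_of_checkB`): a passing check makes the block permanents of the listed family
algebraically independent over `ℂ` (pivot rung `kiPer_algebraicIndependent_of_pivotCertificate`).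
An instance is then a table, `qOf m = q`, and one `decide` (see `DefinabilityGapGhostFive`).
-/

noncomputable section

open Finset
open Literature.Computability.AlgebraicComplexity Literature.Computability.MetaComplexity
open Summit.ValiantsHypothesis.ValiantsHypothesis.Theorems.DefinabilityGapAffineRung
open Summit.ValiantsHypothesis.ValiantsHypothesis.Theorems.DefinabilityGapPivotCertificate
open Summit.ValiantsHypothesis.ValiantsHypothesis.Theorems.DefinabilityGapPivotLive
open Summit.ValiantsHypothesis.ValiantsHypothesis.Theorems.DefinabilityGapGhostThree (Curve
  cellEmb_fst_val cellEmb_snd_val)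

namespace Summit.ValiantsHypothesis.ValiantsHypothesis.Theorems.DefinabilityGapPivotCheck

variable {m q : ℕ}

/-! ## 1. The `ℕ`-model and the check -/

/-- Model cell of curve `t = (t₀,t₁,t₂)` at position `p = (i, j)` of the `m × m` grid over `𝔽_q`:
`(k, (t₀ + t₁ k + t₂ k²) mod q)`, `k = j + m i`. [this file] -/
def mcell (m q : ℕ) (t : Curve) (p : Fin m × Fin m) : ℕ × ℕ :=
  ((p.2 : ℕ) + m * (p.1 : ℕ),
    (t.1 + t.2.1 * ((p.2 : ℕ) + m * (p.1 : ℕ)) + t.2.2 * ((p.2 : ℕ) + m * (p.1 : ℕ)) ^ 2) % q)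

/-- **The pivot-certificate check** (a `Bool`, run by `decide` in the kernel): reduced data;
pairwise distinct pivot cells `(row t, s₀)`; every `sig t` injective with `sig t s₀ = row t`; and
for `i ≠ s₀` the transversal cell `(sig t i, i)` of `t` is not the row-`(sig t i)` gadget cell of
another listed curve `t'` with pivot row `sig t i`. [this file] -/
def pivotCheckB (m q : ℕ) (L : List Curve) (s₀ : Fin m) (row : Curve → Fin m)
    (sig : Curve → Fin m → Fin m) : Bool :=
  decide ((∀ t ∈ L, t.1 < q ∧ t.2.1 < q ∧ t.2.2 < q) ∧
    (∀ t ∈ L, ∀ t' ∈ L, t ≠ t' → mcell m q t (row t, s₀) ≠ mcell m q t' (row t', s₀)) ∧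
    (∀ t ∈ L, Function.Injective (sig t) ∧ sig t s₀ = row t) ∧
    (∀ t ∈ L, ∀ i : Fin m, i ≠ s₀ → ∀ t' ∈ L, t' ≠ t → row t' = sig t i →
      mcell m q t' (sig t i, i) ≠ mcell m q t (sig t i, i)))

/-! ## 2. Transport to the design -/

/-- `n mod q(m)` as an element of `Fin q(m)`. [this file] -/
def natQ (m n : ℕ) : Fin (qOf m) := ⟨n % qOf m, Nat.mod_lt _ (qOf_spec m).2.pos⟩

/-- `(natQ m n : ℕ) = n` for `n < q = q(m)`. [this file] -/
theorem natQ_val (hq : qOf m = q) {n : ℕ} (hn : n < q) : (natQ m n : ℕ) = n := by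
  show n % qOf m = n
  rw [hq]
  exact Nat.mod_eq_of_lt hn

/-- The curve of the design named by the data `t`. [this file] -/
def curveOf (m : ℕ) (t : Curve) : Fin 3 → Fin (qOf m)
  | ⟨0, _⟩ => natQ m t.1
  | ⟨1, _⟩ => natQ m t.2.1
  | _ => natQ m t.2.2

/-- The pair of coordinates of a seed cell, as naturals. [this file] -/
def valPair (x : Fin (qOf m) × Fin (qOf m)) : ℕ × ℕ := ((x.1 : ℕ), (x.2 : ℕ))

/-- The data triple of a curve. [this file] -/
def tripleOf (c : Fin 3 → Fin (qOf m)) : Curve := ((c 0 : ℕ), (c 1 : ℕ), (c 2 : ℕ))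

/-- The family of the design listed by `L`. [this file] -/
def famOf (m : ℕ) (L : List Curve) : Finset (Fin 3 → Fin (qOf m)) :=
  L.toFinset.image (curveOf m)

/-- The pivot-row assignment of the design induced by the model rows. [this file] -/
def rowOf (row : Curve → Fin m) (c : Fin 3 → Fin (qOf m)) : Fin m := row (tripleOf c)

/-- `valPair` is injective. [this file] -/
theorem valPair_injective : Function.Injective (valPair (m := m)) := by
  intro x y h
  simp only [valPair, Prod.mk.injEq] at h
  exact Prod.ext (Fin.ext h.1) (Fin.ext h.2)

/-- Round trip on reduced data. [this file] -/
theorem tripleOf_curveOf (hq : qOf m = q) {t : Curve} (ht : t.1 < q ∧ t.2.1 < q ∧ t.2.2 < q) :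
    tripleOf (curveOf m t) = t := by
  obtain ⟨a, b, c⟩ := t
  show (((natQ m a : Fin (qOf m)) : ℕ), ((natQ m b : Fin (qOf m)) : ℕ),
      ((natQ m c : Fin (qOf m)) : ℕ)) = (a, b, c)
  rw [natQ_val hq ht.1, natQ_val hq ht.2.1, natQ_val hq ht.2.2]

/-- **Cells of a listed curve are computed by the model.** [this file] -/
theorem valPair_cellEmb (hq : qOf m = q) (t : Curve) (ht : t.1 < q ∧ t.2.1 < q ∧ t.2.2 < q)
    (p : Fin m × Fin m) : valPair (cellEmb m (curveOf m t) p) = mcell m q t p := by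
  have h0 : ((curveOf m t 0 : Fin (qOf m)) : ℕ) = t.1 := natQ_val hq ht.1
  have h1 : ((curveOf m t 1 : Fin (qOf m)) : ℕ) = t.2.1 := natQ_val hq ht.2.1
  have h2 : ((curveOf m t 2 : Fin (qOf m)) : ℕ) = t.2.2 := natQ_val hq ht.2.2
  refine Prod.ext ?_ ?_
  · exact cellEmb_fst_val m (curveOf m t) p
  · show ((cellEmb m (curveOf m t) p).2 : ℕ) = _
    rw [cellEmb_snd_val, h0, h1, h2, hq]
    rfl

/-- Members of the listed family are listed curves. [this file] -/
theorem exists_of_mem_famOf {L : List Curve} {c : Fin 3 → Fin (qOf m)} (hc : c ∈ famOf m L) :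
    ∃ t ∈ L, curveOf m t = c := by
  simpa only [famOf, Finset.mem_image, List.mem_toFinset] using hc

/-- The listed family has as many members as the (duplicate-free, reduced) list. [this file] -/
theorem famOf_card (hq : qOf m = q) {L : List Curve} (hL : L.Nodup)
    (hb : ∀ t ∈ L, t.1 < q ∧ t.2.1 < q ∧ t.2.2 < q) : (famOf m L).card = L.length := by
  rw [famOf, Finset.card_image_of_injOn, List.toFinset_card_of_nodup hL]
  intro t ht t' ht' h
  have h1 := congrArg tripleOf h
  rwa [tripleOf_curveOf hq (hb t (by simpa using ht)),
    tripleOf_curveOf hq (hb t' (by simpa using ht'))] at h1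

/-! ## 3. Soundness -/

/-- **Soundness of the check: a pivot certificate.** [this file] -/
theorem kiPivotCertificate_of_checkB (hq : qOf m = q) {L : List Curve} {s₀ : Fin m}
    {row : Curve → Fin m} {sig : Curve → Fin m → Fin m}
    (h : pivotCheckB m q L s₀ row sig = true) :
    KIPivotCertificate m (famOf m L) s₀ (rowOf row) := by
  rw [pivotCheckB, decide_eq_true_iff] at h
  obtain ⟨hb, hinj, hperm, havoid⟩ := h
  refine ⟨?_, ?_⟩
  · intro c hc c' hc' heq
    obtain ⟨t, ht, rfl⟩ := exists_of_mem_famOf hc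
    obtain ⟨t', ht', rfl⟩ := exists_of_mem_famOf hc'
    have htl := hb t ht
    have htl' := hb t' ht'
    by_contra hne
    have hne' : t ≠ t' := fun h => hne (by rw [h])
    refine hinj t ht t' ht' hne' ?_
    have e := congrArg valPair heq
    rw [valPair_cellEmb hq t htl, valPair_cellEmb hq t' htl'] at e
    simpa [rowOf, tripleOf_curveOf hq htl, tripleOf_curveOf hq htl'] using e
  · intro c hc
    obtain ⟨t, ht, rfl⟩ := exists_of_mem_famOf hc
    have htl := hb t ht
    obtain ⟨hi, h0⟩ := hperm t ht
    have hrow : rowOf row (curveOf m t) = row t := by rw [rowOf, tripleOf_curveOf hq htl]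
    refine ⟨Equiv.ofBijective (sig t) (Finite.injective_iff_bijective.mp hi), fun i => ?_, ?_⟩
    · rw [Equiv.ofBijective_apply]
      by_cases his : i = s₀
      · subst his
        rw [h0, ← hrow]
        exact pivot_not_mem_pivotZeros (famOf m L) i (rowOf row) (curveOf m t)
      · intro hmem
        have hne : sig t i ≠ rowOf row (curveOf m t) := by
          rw [hrow, ← h0]
          exact fun h => his (hi h)
        obtain ⟨c', hc', hc'ne, hr, he⟩ := exists_of_mem_pivotZeros hne hmem
        obtain ⟨t', ht', rfl⟩ := exists_of_mem_famOf hc'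
        have htl' := hb t' ht'
        have hne' : t' ≠ t := fun h => hc'ne (by rw [h])
        have hr' : row t' = sig t i := by rw [← hr, rowOf, tripleOf_curveOf hq htl']
        refine havoid t ht i his t' ht' hne' hr' ?_
        have e := congrArg valPair he
        rwa [valPair_cellEmb hq t' htl', valPair_cellEmb hq t htl] at e
    · rw [Equiv.ofBijective_apply, h0, ← hrow]

/-- **Soundness of the check: algebraic independence** of the listed family's block permanents.
[this file] -/
theorem algebraicIndependent_of_checkB (hq : qOf m = q) {L : List Curve} {s₀ : Fin m}
    {row : Curve → Fin m} {sig : Curve → Fin m → Fin m}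
    (h : pivotCheckB m q L s₀ row sig = true) :
    AlgebraicIndependent ℂ (fun c : famOf m L => kiPer m (c : Fin 3 → Fin (qOf m))) :=
  kiPer_algebraicIndependent_of_pivotCertificate m (famOf m L) s₀ (rowOf row)
    (kiPivotCertificate_of_checkB hq h)

end Summit.ValiantsHypothesis.ValiantsHypothesis.Theorems.DefinabilityGapPivotCheck
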